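import Summits.ResolutionOfSingularities.ResolutionOfSingularities.Theorems.MarkedTransferCampaignW46MohWindowSurfaceExitBoundTwo
import HarnessLib

/-!
# [OURS · L1 W4.6 rung (iii-2), HEAVY-ROOT SIDE, `p = 2`] Surface Moh window — THE SHARP LOCAL EXIT BOUND: along every permissible
# sequence inside the purely inseparable surface window at `p = 2`, AT MOST TWO centres lie over any point of stage `0`
# (cell res-hironaka, LADDER-RESOLUTION rung L, D-0089; seat res-L1-s46-pv-5 gen 5; host MarkedTransfer,
# `--supports stmt-ResolutionOfSingularities-16155 --as helper`; statement file `…CampaignW46MohWindowSurface.lean`)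

HONEST FRAMING. Nothing here is a statement of H. Hironaka's manuscript [Hironaka2017] and nothing here asserts that any
statement of it holds. THEOREMS about the OURS regime `CampaignW46.Regime.mohWindowSurface` (o1 §5) at `p = 2`, sharpening the
exit-bound form closed in `…ExitBoundTwo.lean` (`β = 2 · #Sing(E)`) to the POINTWISE bound `β(A, E, x) = 2`: over each point `x` of
stage `0` at most two centres of any in-regime permissible sequence lie (the point itself if it has weight `2`, then its unique
singular child if that child is pure; frozen points are never centres). MECHANISM: along the sequence the singular fibre over `x` is
a SUBSINGLETON at every stage (fibre uniqueness `…CentreFibre.lean` over a centre, injectivity off it) and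
`#centres so far + weight(fibre point) ≤ 2` is preserved (`…TerminationTwo.lean`: transport / drop of the weight; centre weight
`≥ 1`). AI-written; AI review is weaker than expert review. No `sorry`; axioms standard.

WHAT IS PROVED.
* `local_step_of_val` — the abstract one-blow-up step of the invariant «singular fibre over `x` subsingleton, `c + weight ≤ 2`».
* `FinPermissibleRun.card_centres_over_le_two` — **along every finite §2.1-permissible sequence inside `Regime.mohWindowSurface`
  (`p = 2`), at most `2` centres lie over any point of stage `0`**.
* `mohWindowSurfaceInsepFinLocalExitBound_two_sharp` — the content of the named rung `MohWindowSurfaceInsepFinLocalExitBound 2 K`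
  (landed as `mohWindowSurfaceInsepFinLocalExitBound_two`, `β = 2 · #Sing(E)`) with the explicit witness `β = 2`.
  [ZariskiSamuel1960] [Matsumura1987] [HauserWagner2014]
-/

noncomputable section

set_option linter.dupNamespace false -- mandated namespace of this single-conjunct summit

open CategoryTheory AlgebraicGeometry TopologicalSpace IsLocalRing

namespace Summit.ResolutionOfSingularities.ResolutionOfSingularities.Theorems

namespace CampaignW46

open Literature.AlgebraicGeometry.Resolution
open Literature.AlgebraicGeometry.Hironaka2017.S02Preliminaries
open Literature.AlgebraicGeometry.Hironaka2017.Datum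
open Literature.AlgebraicGeometry.Hironaka2017.S16Proof
open Scheme.IdealSheafData

universe u

section Campaign

variable {K : Type u} [Field K] [CharP K 2]
variable {A A' : AmbientDatum 2 K} {E : IdealExponent A.Z}

/-! ## 1. The abstract local step -/

/-- **Abstract local step.** One permissible point blow-up with weights transported off the centre, dropping over it, centre
weight `≥ 1`, at most one singular point over the centre; `g : Z → T` the map to stage `0` and `x` a point there. If the singular
fibre `{y ∈ Sing(E) | g y = x}` is a subsingleton with `c + val y ≤ 2` on it (`c ≤ 2` the number of earlier centres over `x`), and
`c′ ≤ c + 1`, `c′ ≤ c` unless the centre lies over `x`, then the same holds one stage up for `g ∘ π`, `c′`, `val′`. [folklore] -/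
theorem local_step_of_val {D : Closeds A.Z} (π : A'.Z ⟶ A.Z)
    (hπ : IsBlowup π (vanishingIdeal D)) (hD : E.IsPermissibleCentre A.hom D) (hfin : E.sing.Finite)
    (hcl : E.sing ⊆ Literature.AlgebraicGeometry.Hironaka2017.S02Preliminaries.closedPoints A.Z)
    (val : A.Z → ℕ) (val' : A'.Z → ℕ)
    (hoff : ∀ x' ∈ (E.transform π D).sing, π.base x' ∉ (D : Set A.Z) → val' x' = val (π.base x'))
    (hon : ∀ x' ∈ (E.transform π D).sing, π.base x' ∈ (D : Set A.Z) → val' x' < val (π.base x'))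
    (hpos : ∀ ξ ∈ (D : Set A.Z), 1 ≤ val ξ)
    (huniq : ((E.transform π D).sing ∩ π.base ⁻¹' (D : Set A.Z)).Subsingleton)
    {T : Type*} (g : A.Z → T) (x : T) (c c' : ℕ)
    (hF : {y | y ∈ E.sing ∧ g y = x}.Subsingleton) (hcF : ∀ y ∈ E.sing, g y = x → c + val y ≤ 2) (hc2 : c ≤ 2)
    (hc' : c' ≤ c + 1) (hc'' : (∀ y ∈ (D : Set A.Z), g y ≠ x) → c' ≤ c) :
    {y' | y' ∈ (E.transform π D).sing ∧ g (π.base y') = x}.Subsingleton ∧ c' ≤ 2 ∧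
      ∀ y' ∈ (E.transform π D).sing, g (π.base y') = x → c' + val' y' ≤ 2 := by
  classical
  obtain ⟨ξ, hξS, hξcl, hDξ⟩ := IsPermissibleCentre.exists_eq_singleton_of_isolatedSing hD ⟨hfin, hcl⟩
  have hξD : ξ ∈ (D : Set A.Z) := by rw [hDξ]; exact Set.mem_singleton ξ
  by_cases hξx : g ξ = x
  · -- the centre lies over `x`: every singular point over `x` upstairs lies over the centre
    have hover : ∀ y' ∈ (E.transform π D).sing, g (π.base y') = x → π.base y' ∈ (D : Set A.Z) := by
      intro y' hy' hgy'
      by_contra hnot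
      have hyS : π.base y' ∈ E.sing := MohWindowSurfacePermissible.base_mem_sing_of_not_over_centre π hπ hy' hnot
      have : π.base y' = ξ := hF ⟨hyS, hgy'⟩ ⟨hξS, hξx⟩
      exact hnot (this ▸ hξD)
    have hcξ : c + val ξ ≤ 2 := hcF ξ hξS hξx
    have h1ξ : 1 ≤ val ξ := hpos ξ hξD
    refine ⟨fun y₁ h₁ y₂ h₂ => huniq ⟨h₁.1, hover y₁ h₁.1 h₁.2⟩ ⟨h₂.1, hover y₂ h₂.1 h₂.2⟩, by omega, fun y' hy' hgy' => ?_⟩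
    have hyD := hover y' hy' hgy'
    have hlt := hon y' hy' hyD
    have hπy : π.base y' = ξ := by rw [hDξ] at hyD; exact hyD
    rw [hπy] at hlt
    omega
  · -- the centre does not lie over `x`: transport
    have hDx : ∀ y ∈ (D : Set A.Z), g y ≠ x := fun y hy => by
      rw [hDξ] at hy; rw [show y = ξ from hy]; exact hξx
    have hcc : c' ≤ c := hc'' hDx
    have hnotD : ∀ y' ∈ (E.transform π D).sing, g (π.base y') = x → π.base y' ∉ (D : Set A.Z) :=
      fun y' _ hgy' hyD => hDx _ hyD hgy'
    refine ⟨fun y₁ h₁ y₂ h₂ => ?_, by omega, fun y' hy' hgy' => ?_⟩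
    · have hn₁ := hnotD y₁ h₁.1 h₁.2
      have hn₂ := hnotD y₂ h₂.1 h₂.2
      have hS₁ : π.base y₁ ∈ E.sing := MohWindowSurfacePermissible.base_mem_sing_of_not_over_centre π hπ h₁.1 hn₁
      have hS₂ : π.base y₂ ∈ E.sing := MohWindowSurfacePermissible.base_mem_sing_of_not_over_centre π hπ h₂.1 hn₂
      have heq : π.base y₁ = π.base y₂ := hF ⟨hS₁, h₁.2⟩ ⟨hS₂, h₂.2⟩
      exact MohWindow.injOn_preimage_compl hπ hn₁ hn₂ heq
    · have hn := hnotD y' hy' hgy'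
      have hS : π.base y' ∈ E.sing := MohWindowSurfacePermissible.base_mem_sing_of_not_over_centre π hπ hy' hn
      have := hcF _ hS hgy'
      rw [hoff y' hy' hn]
      omega

/-! ## 2. The run: at most two centres over any point of stage `0` -/

/-- `Z_{m+1} → Z_0` is `π_m` followed by `Z_m → Z_0`, on points. [folklore] -/
theorem FinPermissibleRun.down_succ_apply {p : ℕ} [Fact p.Prime] {K : Type u} [Field K] [CharP K p]
    (r : FinPermissibleRun p K) (m : ℕ) (y : (r.A (m + 1)).Z) : (r.down (m + 1)).base y = (r.down m).base ((r.π m).base y) :=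
  rfl

open scoped Classical in
/-- **[OURS · L1 W4.6 rung (iii-2), `p = 2`] AT MOST TWO CENTRES OVER ANY POINT.** For a finite §2.1-permissible sequence all of
whose stages lie in `Regime.mohWindowSurface` (`p = 2`), a point `x` of stage `0` and a finite set `s` of indices `m < len` whose
centre `D_m` meets the fibre of `Z_m → Z_0` over `x`: `#s ≤ 2`. Invariant along the sequence: the singular fibre over `x` is a
subsingleton and `#{m ∈ s | m < k} + weight ≤ 2` on it (`local_step_of_val` with `…TerminationTwo`'s transport/drop,
`one_le_weight_of_mem_centre`, fibre uniqueness). NOT a statement of the manuscript. [folklore] -/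
theorem FinPermissibleRun.card_centres_over_le_two (r : FinPermissibleRun 2 K)
    (hr : ∀ k, k ≤ r.len → Regime.mohWindowSurface (r.A k) (r.E k)) (x : (r.A 0).Z) (s : Finset ℕ)
    (hs : ∀ m ∈ s, m < r.len ∧ ∃ y ∈ (r.D m : Set (r.A m).Z), r.down m y = x) : s.card ≤ 2 := by
  classical
  let val : (k : ℕ) → (r.A k).Z → ℕ := fun k y =>
    if ∃ s q w η ρ η_S η_Q η_W : (r.A k).Z.presheaf.stalk y, Ideal.span {s, q, w} = maximalIdeal _ ∧
        η - (η_S * s + η_Q * q + η_W * w) ∈ maximalIdeal _ ^ 2 ∧ IsUnit η_Q ∧ ρ ∈ maximalIdeal _ ^ 4 ∧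
        stalkIdeal (r.E k).J y = Ideal.span {w ^ 2 + (s ^ 2 * η + ρ)} then 0
      else if ∃ s q w η G η_S η_Q η_W : (r.A k).Z.presheaf.stalk y, Ideal.span {s, q, w} = maximalIdeal _ ∧
        η - (η_S * s + η_Q * q + η_W * w) ∈ maximalIdeal _ ^ 2 ∧ IsUnit η_S ∧ η_Q ∈ maximalIdeal _ ∧ IsUnit G ∧
        stalkIdeal (r.E k).J y = Ideal.span {w ^ 2 + (s ^ 2 * η + s * q ^ 3 * G)} then 1 else 2
  let c : ℕ → ℕ := fun k => (s.filter fun m => m < k).card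
  -- the local step, stated for an arbitrary next stage `E₁ = transform` (dependent rewriting along `E_succ`)
  have key : ∀ k (hk : Regime.mohWindowSurface (r.A k) (r.E k)) (E₁ : IdealExponent (r.A (k + 1)).Z)
      (h₁ : Regime.mohWindowSurface (r.A (k + 1)) E₁) (heq : E₁ = (r.E k).transform (r.π k) (r.D k))
      (hperm : (r.E k).IsPermissibleCentre (r.A k).hom (r.D k)) (hbl : IsBlowup (r.π k) (vanishingIdeal (r.D k)))
      (c₀ c₁ : ℕ) (hF : {y | y ∈ (r.E k).sing ∧ (r.down k).base y = x}.Subsingleton)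
      (hcF : ∀ y ∈ (r.E k).sing, (r.down k).base y = x → c₀ + val k y ≤ 2) (hc2 : c₀ ≤ 2) (hc' : c₁ ≤ c₀ + 1)
      (hc'' : (∀ y ∈ (r.D k : Set (r.A k).Z), (r.down k).base y ≠ x) → c₁ ≤ c₀),
      {y' | y' ∈ E₁.sing ∧ (r.down k).base ((r.π k).base y') = x}.Subsingleton ∧ c₁ ≤ 2 ∧
        ∀ y' ∈ E₁.sing, (r.down k).base ((r.π k).base y') = x → c₁ +
          (if ∃ s q w η ρ η_S η_Q η_W : (r.A (k + 1)).Z.presheaf.stalk y',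
            Ideal.span {s, q, w} = maximalIdeal _ ∧ η - (η_S * s + η_Q * q + η_W * w) ∈ maximalIdeal _ ^ 2 ∧ IsUnit η_Q ∧
            ρ ∈ maximalIdeal _ ^ 4 ∧ stalkIdeal E₁.J y' = Ideal.span {w ^ 2 + (s ^ 2 * η + ρ)} then 0
          else if ∃ s q w η G η_S η_Q η_W : (r.A (k + 1)).Z.presheaf.stalk y', Ideal.span {s, q, w} = maximalIdeal _ ∧
            η - (η_S * s + η_Q * q + η_W * w) ∈ maximalIdeal _ ^ 2 ∧ IsUnit η_S ∧ η_Q ∈ maximalIdeal _ ∧ IsUnit G ∧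
            stalkIdeal E₁.J y' = Ideal.span {w ^ 2 + (s ^ 2 * η + s * q ^ 3 * G)} then 1 else 2) ≤ 2 := by
    intro k hk E₁ h₁ heq hperm hbl c₀ c₁ hF hcF hc2 hc' hc''
    subst heq
    exact local_step_of_val (r.π k) hbl hperm hk.2.1 hk.2.2.1 _ _
      (fun x' _ hover => weight_eq_of_not_over_centre (E := r.E k) (r.π k) hbl hover)
      (fun x' hx' hover => weight_lt_of_over_centre (r.π k) hbl hperm hk h₁ hx' hover)
      (fun ξ hξ => one_le_weight_of_mem_centre (r.π k) hbl hperm hk h₁ hξ)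
      (sing_inter_preimage_centre_subsingleton (r.π k) hbl hperm hk h₁)
      (fun y => (r.down k).base y) x c₀ c₁ hF hcF hc2 hc' hc''
  -- the invariant along the sequence
  have hinv : ∀ k, k ≤ r.len →
      {y | y ∈ (r.E k).sing ∧ (r.down k).base y = x}.Subsingleton ∧ c k ≤ 2 ∧
        ∀ y ∈ (r.E k).sing, (r.down k).base y = x → c k + val k y ≤ 2 := by
    intro k
    induction k with
    | zero =>
      intro _
      have hc0 : c 0 = 0 := by
        show (s.filter fun m => m < 0).card = 0
        rw [Finset.card_eq_zero, Finset.filter_eq_empty_iff]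
        intro m _
        exact Nat.not_lt_zero m
      refine ⟨fun y₁ h₁ y₂ h₂ => ?_, by rw [hc0]; exact Nat.zero_le _, fun y _ _ => ?_⟩
      · have e₁ : y₁ = x := h₁.2
        have e₂ : y₂ = x := h₂.2
        rw [e₁, e₂]
      · rw [hc0, zero_add]
        simp only [val]
        split_ifs <;> norm_num
    | succ k ih =>
      intro hk1
      have hk : k ≤ r.len := Nat.le_of_succ_le hk1
      have hklt : k < r.len := hk1
      obtain ⟨hF, hc2, hcF⟩ := ih hk
      -- `c (k+1) ≤ c k + 1`, and `= c k` unless the centre meets the fibre over `x`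
      have hsub : (s.filter fun m => m < k + 1) ⊆ insert k (s.filter fun m => m < k) := by
        intro m hm
        rw [Finset.mem_filter] at hm
        rcases Nat.lt_succ_iff_lt_or_eq.mp hm.2 with h | rfl
        · exact Finset.mem_insert_of_mem (Finset.mem_filter.mpr ⟨hm.1, h⟩)
        · exact Finset.mem_insert_self _ _
      have hc' : c (k + 1) ≤ c k + 1 :=
        (Finset.card_le_card hsub).trans (Finset.card_insert_le _ _)
      have hc'' : (∀ y ∈ (r.D k : Set (r.A k).Z), (r.down k).base y ≠ x) → c (k + 1) ≤ c k := by
        intro hno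
        have hks : k ∉ s := fun hks => by
          obtain ⟨-, y, hy, hyx⟩ := hs k hks
          exact hno y hy hyx
        have heq : (s.filter fun m => m < k + 1) = s.filter fun m => m < k := by
          ext m
          simp only [Finset.mem_filter]
          constructor
          · rintro ⟨hm, hlt⟩
            rcases Nat.lt_succ_iff_lt_or_eq.mp hlt with h | rfl
            · exact ⟨hm, h⟩
            · exact absurd hm hks
          · rintro ⟨hm, hlt⟩
            exact ⟨hm, Nat.lt_succ_of_lt hlt⟩
        show (s.filter fun m => m < k + 1).card ≤ (s.filter fun m => m < k).card
        rw [heq]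
      have hstep : {y' | y' ∈ (r.E (k + 1)).sing ∧ (r.down k).base ((r.π k).base y') = x}.Subsingleton ∧ c (k + 1) ≤ 2 ∧
          ∀ y' ∈ (r.E (k + 1)).sing, (r.down k).base ((r.π k).base y') = x → c (k + 1) + val (k + 1) y' ≤ 2 :=
        key k (hr k hk) (r.E (k + 1)) (hr (k + 1) hk1) (r.E_succ k hklt) (r.permissible k hklt) (r.blowup k hklt)
          (c k) (c (k + 1)) hF hcF hc2 hc' hc''
      exact hstep
  -- conclusion: `#s = c len ≤ 2`
  have hsc : s = s.filter fun m => m < r.len := by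
    ext m
    simp only [Finset.mem_filter]
    exact ⟨fun hm => ⟨hm, (hs m hm).1⟩, fun h => h.1⟩
  have := (hinv r.len le_rfl).2.1
  rw [hsc]
  exact this

/-! ## 3. The named rung with the sharp witness `β = 2` -/

/-- **[OURS · L1 W4.6 rung (iii-2), `p = 2`] `MohWindowSurfaceInsepFinLocalExitBound 2 K` WITH `β = 2`**: along every finite
§2.1-permissible sequence inside o1's purely inseparable surface-window regime `regimeMohWindowSurfaceInsep` at `p = 2`, at most
TWO centres lie over any point of stage `0`; every field `K` of characteristic `2`. NOT a statement of the manuscript. [folklore] -/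
theorem mohWindowSurfaceInsepFinLocalExitBound_two_sharp (K : Type u) [Field K] [CharP K 2] :
    ∃ β : ∀ A : AmbientDatum 2 K, IdealExponent A.Z → A.Z → ℕ, (∀ A E x, β A E x = 2) ∧
      ∀ r : FinPermissibleRun 2 K, (∀ k, k ≤ r.len → regimeMohWindowSurfaceInsep (p := 2) (K := K) (r.A k) (r.E k)) →
        ∀ (x : (r.A 0).Z) (s : Finset ℕ),
          (∀ m ∈ s, m < r.len ∧ ∃ y ∈ (r.D m : Set (r.A m).Z), r.down m y = x) → s.card ≤ β (r.A 0) (r.E 0) x :=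
  ⟨fun _ _ _ => 2, fun _ _ _ => rfl, fun r hr x s hs => FinPermissibleRun.card_centres_over_le_two r
    (fun k hk => (regimeMohWindowSurfaceInsep_iff_mohWindowSurface _ _).mp (hr k hk)) x s hs⟩

end Campaign

end CampaignW46

end Summit.ResolutionOfSingularities.ResolutionOfSingularities.Theorems

end
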